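import Summits.CriticalPhenomena.SAWScalingLimit.Theorems.SAWAsymptoticMoreraZ2VertexIdentityPrelim
import Literature.Probability.LatticeModels.MedialWindingBridge

/-!
# `SAWAsymptoticMorera.Z2VertexIdentity` (stmt-CriticalPhenomena-6859): the square-lattice
Duminil-Copin–Smirnov vertex identity with remainder — proved for bounded domains

Route `SAWAsymptoticMorera` of `CriticalPhenomena/SAWScalingLimit`, support item
`Z2VertexIdentity`: for the critical square-lattice mid-edge parafermionic half-edge terms
`H(p, q)` (walks `a → p` of `Ω_δ`, half-step toward `q`, winding measured from the reference
site `a'`), their 'type-1' parts `T_d` at `(v - d, v)` (walks to `v - d` never visiting `v`) and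
the loop returns `L_d = H(v - d, v) - T_d`, at an interior vertex `v ≠ a`:
`Σ_d d · (H(v, v + d) + H(v + d, v)) = (x_c (1 + 2 sin(5π/16)) - 1) · Σ_d d · T_d - Σ_d d · L_d`.

## Proof (DCS's regrouping, [DuminilCopinSmirnov2012, proof of Lemma 1], transposed to `ℤ²`)

* `Σ_d d · H(v + d, v) = -Σ_d d · H(v - d, v)` (reindex `d ↦ -d`), so the loop-return terms
  cancel and the identity is equivalent to `Σ_d d · H(v, v + d) = x_c (1 + 2 sin(5π/16)) Σ_d d · T_d`.
* Walks `a → v` are in bijection with pairs (last step `d`, walk `a → v - d` avoiding `v`)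
  (`SimpleGraph.Walk.concat`); the walk to `v` not using the edge `{v, v + d'}` continued to the
  middle of that edge is the type-1 configuration at `(v - d, v)` prolonged by one step, going
  straight (`d' = d`), turning left or turning right: weight `× x_c`, winding `+ 0, + π/2, - π/2`
  (additivity of the polyline winding, `winding_concat₃`, `winding_concat_right_ray`).
* Per incoming direction the three exits contribute `d (1 + i e^{-i5π/16} - i e^{i5π/16})
  = d (1 + 2 sin(5π/16))`.

All sums are finite for a bounded `Ω` and `δ > 0` (`finite_domainSAW_of_finite`). AS FILED the item
quantifies over every `Ω : Set ℂ`; for unbounded `Ω` (e.g. `Ω = univ`, where `Ω_δ = ℤ²`) the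
`tsum`s range over infinite families whose summability is the finiteness of critical two-point
functions of the planar SAW — open — and the junk value `0` of a non-summable `tsum` makes the
identity hinge on it; the theorems here carry the hypothesis that the walk spaces are finite
(`z2VertexIdentity_of_finite`), in particular `Bornology.IsBounded Ω`
(`z2VertexIdentity_of_isBounded`, the item's statement verbatim with that one extra hypothesis).
-/

noncomputable section

open Literature.Probability.LatticeModels Literature.Probability.RandomPlanarGeometry
open Literature.Probability.RandomPlanarGeometry.SAW Complex

namespace Summit.CriticalPhenomena.SAWScalingLimit.Theorems.Z2Vertex

/-! ### The half-edge terms and their type-1 parts -/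

section Terms

variable {Ω : Set ℂ} {δ : ℝ} {a a' v : Site 2}

/-- The half-edge term `H(p, q)`: walks `a → p` of `Ω_δ` not having used the edge `{p, q}`,
continued to the middle of `{p, q}`, weight `e^{-i(5/8)W} x_c^{|γ|+1}` with the winding `W`
measured from the reference site `a'` (the item's `H`). [cite: DuminilCopinSmirnov2012, Def. 1] -/
def Hterm (Ω : Set ℂ) (δ : ℝ) (a a' p q : Site 2) : ℂ :=
  ∑' γ : DomainSAW Ω δ a p, if s(p, q) ∈ γ.walk.edges then 0 else
    pathWeight δ a' γ.walk.support (medialPoint δ s(p, q)) γ.length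

/-- The type-1 part `T_d` of `H(v - d, v)`: walks to `v - d` never visiting `v` (the item's `T`).
[cite: DuminilCopinSmirnov2012, proof of Lemma 1] -/
def Tterm (Ω : Set ℂ) (δ : ℝ) (a a' v d : Site 2) : ℂ :=
  ∑' γ : DomainSAW Ω δ a (v - d), if v ∈ γ.walk.support then 0 else
    pathWeight δ a' γ.walk.support (medialPoint δ s(v - d, v)) γ.length

/-- The type-1 sum in direction `k`, as a sum over the type-1 class. [folklore] -/
def Tsum (Ω : Set ℂ) (δ : ℝ) (a a' v : Site 2) (k : Fin 4) : ℂ :=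
  ∑' γ : TSet Ω δ a v k, pathWeight δ a' γ.1.walk.support (medialPoint δ s(v - dir4 k, v)) γ.1.length

/-- `T_{dir4 k}` is the sum over the type-1 class. [folklore] -/
theorem Tterm_dir4 (k : Fin 4) : Tterm Ω δ a a' v (dir4 k) = Tsum Ω δ a a' v k := by
  classical
  have h := tsum_subtype (TSet Ω δ a v k)
    (fun γ => pathWeight δ a' γ.walk.support (medialPoint δ s(v - dir4 k, v)) γ.length)
  rw [Tsum, h, Tterm]
  refine tsum_congr fun γ => ?_
  rw [Set.indicator_apply]
  by_cases hv : v ∈ γ.walk.support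
  · rw [if_pos hv, if_neg (fun h' => (mem_TSet.1 h') hv)]
  · rw [if_neg hv, if_pos (mem_TSet.2 hv)]

/-- The phase picked up at `v` by a walk arriving along `dir4 k` and leaving toward `dir4 i`
(`0` for the excluded reversal `i = k + 2`). [cite: DuminilCopinSmirnov2012, proof of Lemma 1] -/
def phase (k i : Fin 4) : ℂ :=
  if i = k + 2 then 0 else
    Complex.exp (-Complex.I * (5 / 8 : ℂ) * (Complex.arg (cdir4 i / cdir4 k) : ℝ))

/-- Going straight picks up no phase. [folklore] -/
theorem phase_self (k : Fin 4) : phase k k = 1 := by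
  have hk : ¬ (k = k + 2) := by fin_cases k <;> decide
  rw [phase, if_neg hk, div_self (cdir4_ne_zero k), Complex.arg_one]
  simp

/-- A left turn picks up `e^{-i5π/16}`. [folklore] -/
theorem phase_left (k : Fin 4) :
    phase k (k + 1) = Complex.exp (-Complex.I * (5 / 8 : ℂ) * ((Real.pi / 2 : ℝ) : ℂ)) := by
  have hk : ¬ (k + 1 = k + 2) := by fin_cases k <;> decide
  have hq : cdir4 (k + 1) / cdir4 k = Complex.I := by
    rw [div_eq_iff (cdir4_ne_zero k)]
    fin_cases k <;> simp [cdir4]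
  rw [phase, if_neg hk, hq, Complex.arg_I]

/-- The reversal is excluded. [folklore] -/
theorem phase_back (k : Fin 4) : phase k (k + 2) = 0 := by
  rw [phase, if_pos rfl]

/-- A right turn picks up `e^{+i5π/16}`. [folklore] -/
theorem phase_right (k : Fin 4) :
    phase k (k + 3) = Complex.exp (-Complex.I * (5 / 8 : ℂ) * ((-(Real.pi / 2) : ℝ) : ℂ)) := by
  have hk : ¬ (k + 3 = k + 2) := by fin_cases k <;> decide
  have hq : cdir4 (k + 3) / cdir4 k = -Complex.I := by
    rw [div_eq_iff (cdir4_ne_zero k)]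
    fin_cases k <;> simp [cdir4]
  rw [phase, if_neg hk, hq, Complex.arg_neg_I]

/-- Turning left multiplies the direction by `i`. [folklore] -/
theorem cdir4_add_one (k : Fin 4) : cdir4 (k + 1) = Complex.I * cdir4 k := by
  fin_cases k <;> simp [cdir4]

/-- Turning right multiplies the direction by `-i`. [folklore] -/
theorem cdir4_add_three (k : Fin 4) : cdir4 (k + 3) = -Complex.I * cdir4 k := by
  fin_cases k <;> simp [cdir4]

/-- **Grouping the walks to `v` by their last step**: the half-edge term out of `v` toward
`v + dir4 i` is `x_c Σ_k phase(k, i) T_k`. [cite: DuminilCopinSmirnov2012, proof of Lemma 1] -/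
theorem Hterm_out (hfin : ∀ p, Finite (DomainSAW Ω δ a p)) (hδ : 0 < δ)
    (hadj : ∀ k, (discreteDomainGraph Ω δ).Adj (v - dir4 k) v) (hva : v ≠ a) (i : Fin 4) :
    Hterm Ω δ a a' v (v + dir4 i) =
      (criticalFugacity : ℂ) * ∑ k : Fin 4, phase k i * Tsum Ω δ a a' v k := by
  rw [Hterm, tsum_eq_sum_tsum_extend hfin hadj hva, Finset.mul_sum]
  refine Finset.sum_congr rfl fun k _ => ?_
  have hrw : ∀ γ : TSet Ω δ a v k,
      (if s(v, v + dir4 i) ∈ (extend hadj k γ).walk.edges then (0 : ℂ) else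
        pathWeight δ a' (extend hadj k γ).walk.support (medialPoint δ s(v, v + dir4 i))
          (extend hadj k γ).length) =
      phase k i * ((criticalFugacity : ℂ) *
        pathWeight δ a' γ.1.walk.support (medialPoint δ s(v - dir4 k, v)) γ.1.length) := by
    intro γ
    have hcond : s(v, v + dir4 i) ∈ (extend hadj k γ).walk.edges ↔ i = k + 2 :=
      mem_edges_extend_iff hadj k i γ
    by_cases hik : i = k + 2
    · rw [if_pos (hcond.2 hik), phase, if_pos hik, zero_mul]
    · rw [if_neg (mt hcond.1 hik), phase, if_neg hik]
      have := pathWeight_extend hδ a' hadj k i γ.1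
      rw [show (extend hadj k γ).length = (γ.1.walk.concat (hadj k)).length from rfl,
        show (extend hadj k γ).walk.support = (γ.1.walk.concat (hadj k)).support from rfl, this]
      ring
  rw [tsum_congr hrw, tsum_mul_left, Tsum, tsum_mul_left]
  ring

/-- `i(e^{-i5π/16} - e^{i5π/16}) = 2 sin(5π/16)`. [folklore] -/
theorem key_trig :
    Complex.I * Complex.exp (-Complex.I * (5 / 8 : ℂ) * ((Real.pi / 2 : ℝ) : ℂ)) -
      Complex.I * Complex.exp (-Complex.I * (5 / 8 : ℂ) * ((-(Real.pi / 2) : ℝ) : ℂ)) =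
      2 * ((Real.sin (5 * Real.pi / 16) : ℝ) : ℂ) := by
  rw [Complex.ofReal_sin, Complex.sin]
  have h1 : -Complex.I * (5 / 8 : ℂ) * ((Real.pi / 2 : ℝ) : ℂ) =
      -((5 * Real.pi / 16 : ℝ) : ℂ) * Complex.I := by push_cast; ring
  have h2 : -Complex.I * (5 / 8 : ℂ) * ((-(Real.pi / 2) : ℝ) : ℂ) =
      ((5 * Real.pi / 16 : ℝ) : ℂ) * Complex.I := by push_cast; ring
  rw [h1, h2]
  ring

/-- **The three exits of an incoming direction contribute `d (1 + 2 sin(5π/16))`**: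
`Σ_i cdir4 i · phase(k, i) = cdir4 k · (1 + 2 sin(5π/16))` (straight `1`, left turn
`i e^{-i5π/16}`, right turn `-i e^{i5π/16}`). [cite: DuminilCopinSmirnov2012, proof of Lemma 1] -/
theorem sum_cdir4_mul_phase (k : Fin 4) :
    ∑ i : Fin 4, cdir4 i * phase k i =
      cdir4 k * (1 + 2 * ((Real.sin (5 * Real.pi / 16) : ℝ) : ℂ)) := by
  have hk := key_trig
  rw [← Equiv.sum_comp (Equiv.addLeft k)]
  simp only [Equiv.coe_addLeft, Fin.sum_univ_four, add_zero, phase_self, phase_left, phase_back,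
    phase_right, cdir4_add_one, cdir4_add_three]
  linear_combination (cdir4 k) * hk

/-- The loop-side terms reindex: `Σ_i cdir4 i · H(v + dir4 i, v) = -Σ_i cdir4 i · H(v - dir4 i, v)`.
[folklore] -/
theorem sum_cdir4_Hterm_in (Ω : Set ℂ) (δ : ℝ) (a a' v : Site 2) :
    ∑ i : Fin 4, cdir4 i * Hterm Ω δ a a' (v + dir4 i) v =
      -∑ i : Fin 4, cdir4 i * Hterm Ω δ a a' (v - dir4 i) v := by
  rw [← Equiv.sum_comp (Equiv.addRight (2 : Fin 4)), ← Finset.sum_neg_distrib]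
  refine Finset.sum_congr rfl fun i _ => ?_
  rw [Equiv.coe_addRight, cdir4_add_two, dir4_add_two, ← sub_eq_add_neg]
  ring

/-- **The square-lattice vertex identity with remainder, core form**: for finite walk spaces,
`δ > 0`, `v ≠ a` and `v` joined to its four neighbours in `Ω_δ`,
`Σ_i cdir4 i (H(v, v + dir4 i) + H(v + dir4 i, v))
  = (x_c (1 + 2 sin(5π/16)) - 1) Σ_i cdir4 i T_{dir4 i} - Σ_i cdir4 i (H(v - dir4 i, v) - T_{dir4 i})`.
[cite: DuminilCopinSmirnov2012, proof of Lemma 1] -/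
theorem vertex_identity (hfin : ∀ p, Finite (DomainSAW Ω δ a p)) (hδ : 0 < δ) (hva : v ≠ a)
    (hadj : ∀ i : Fin 4, (discreteDomainGraph Ω δ).Adj v (v + dir4 i)) :
    ∑ i : Fin 4, cdir4 i * (Hterm Ω δ a a' v (v + dir4 i) + Hterm Ω δ a a' (v + dir4 i) v) =
      ((criticalFugacity : ℂ) * (1 + 2 * ((Real.sin (5 * Real.pi / 16) : ℝ) : ℂ)) - 1) *
          ∑ i : Fin 4, cdir4 i * Tterm Ω δ a a' v (dir4 i) -
        ∑ i : Fin 4, cdir4 i * (Hterm Ω δ a a' (v - dir4 i) v - Tterm Ω δ a a' v (dir4 i)) := by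
  have hadj' : ∀ k, (discreteDomainGraph Ω δ).Adj (v - dir4 k) v := by
    intro k
    have h := hadj (k + 2)
    rw [dir4_add_two, ← sub_eq_add_neg] at h
    exact h.symm
  -- the terms out of `v`
  have hout : ∑ i : Fin 4, cdir4 i * Hterm Ω δ a a' v (v + dir4 i) =
      (criticalFugacity : ℂ) * (1 + 2 * ((Real.sin (5 * Real.pi / 16) : ℝ) : ℂ)) *
        ∑ k : Fin 4, cdir4 k * Tterm Ω δ a a' v (dir4 k) := by
    simp_rw [Hterm_out hfin hδ hadj' hva, Tterm_dir4]
    calc ∑ i : Fin 4, cdir4 i * ((criticalFugacity : ℂ) * ∑ k : Fin 4, phase k i * Tsum Ω δ a a' v k)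
        = (criticalFugacity : ℂ) * ∑ k : Fin 4, (∑ i : Fin 4, cdir4 i * phase k i) *
            Tsum Ω δ a a' v k := by
          simp_rw [Finset.mul_sum, Finset.sum_mul, Finset.mul_sum]
          rw [Finset.sum_comm]
          refine Finset.sum_congr rfl fun k _ => Finset.sum_congr rfl fun i _ => ?_
          ring
      _ = (criticalFugacity : ℂ) * (1 + 2 * ((Real.sin (5 * Real.pi / 16) : ℝ) : ℂ)) *
            ∑ k : Fin 4, cdir4 k * Tsum Ω δ a a' v k := by
          simp_rw [sum_cdir4_mul_phase, Finset.mul_sum]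
          refine Finset.sum_congr rfl fun k _ => ?_
          ring
  simp_rw [mul_add, Finset.sum_add_distrib, hout, sum_cdir4_Hterm_in, mul_sub,
    Finset.sum_sub_distrib]
  ring

end Terms

/-! ### The item's statement, for finite walk spaces and for bounded domains -/

/-- **`Z2VertexIdentity` for a finite discrete domain**: the item's statement verbatim with the
extra hypothesis `(meshDomain Ω δ).Finite` (after `0 < δ`). [cite: DuminilCopinSmirnov2012, proof of Lemma 1] -/
theorem z2VertexIdentity_of_finite :
    ∀ (Ω : Set ℂ) (δ : ℝ) (a a' v : Literature.Probability.LatticeModels.Site 2), let H : Literature.Probability.LatticeModels.Site 2 → Literature.Probability.LatticeModels.Site 2 → ℂ := fun p q => ∑' γ : Literature.Probability.RandomPlanarGeometry.SAW.DomainSAW Ω δ a p, if s(p, q) ∈ γ.walk.edges then 0 else Complex.exp (-Complex.I * (5 / 8 : ℂ) * (Literature.Probability.LatticeModels.winding (Literature.Probability.LatticeModels.meshPoint δ a' :: (γ.walk.support.map (Literature.Probability.LatticeModels.meshPoint δ)) ++ [Literature.Probability.LatticeModels.medialPoint δ s(p, q)]) : ℝ)) * (Literature.Probability.RandomPlanarGeometry.SAW.criticalFugacity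 : ℂ) ^ (γ.length + 1); let T : Literature.Probability.LatticeModels.Site 2 → ℂ := fun d => ∑' γ : Literature.Probability.RandomPlanarGeometry.SAW.DomainSAW Ω δ a (v - d), if v ∈ γ.walk.support then 0 else Complex.exp (-Complex.I * (5 / 8 : ℂ) * (Literature.Probability.LatticeModels.winding (Literature.Probability.LatticeModels.meshPoint δ a' :: (γ.walk.support.map (Literature.Probability.LatticeModels.meshPoint δ)) ++ [Literature.Probability.LatticeModels.medialPoint δ s(v - d, v)]) : ℝ)) * (Literature.Probability.RandomPlanarGeometry.SAW.criticalFugacity : ℂ) ^ (γ.length + 1); let dir : Fin 4 → Literature.Probability.LatticeModels.Site 2 := ![![1, 0], ![0, 1], ![-1, 0], ![0, -1]]; let cdir : Fin 4 → ℂ := ![1, Complex.I, -1, -Complex.I]; 0 < δ → (Literature.Probability.LatticeModels.meshDomain Ω δ).Finite → v ≠ a → (∀ i : Fin 4, (Literature.Probability.LatticeModels.discreteDomainGraph Ω δ).Adj v (v + dir i)) → ∑ i : Fin 4, cdir i * (H v (v + dir i) + H (v + dir i) v) = ((Literature.Probability.RandomPlanarGeometry.SAW.criticalFugacity : ℂ)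 * (1 + 2 * Real.sin (5 * Real.pi / 16)) - 1) * ∑ i : Fin 4, cdir i * T (dir i) - ∑ i : Fin 4, cdir i * (H (v - dir i) v - T (dir i)) := by
  intro Ω δ a a' v
  simp only []
  intro hδ hΩ hva hadj
  -- buildfix 2026-08-20: the item's statement spells FermionicObservable's `winding`, the development the
  -- `Polyline` copy (two constants since the 2026-08-15 Literature migration): align with the bridge lemma.
  rw [← Literature.Probability.LatticeModels.Polyline.winding_eq_winding']
  exact vertex_identity (fun p => finite_domainSAW_of_finite hΩ a p) hδ hva hadj

/-- **`Z2VertexIdentity` for bounded domains** (DCS's setting: a finite domain): the item's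
statement verbatim with the extra hypothesis `Bornology.IsBounded Ω` (after `0 < δ`). This is
the repaired form of stmt-CriticalPhenomena-6859; as filed (all `Ω : Set ℂ`) the `tsum`s may be
junk for unbounded `Ω` (see the module docstring). [cite: DuminilCopinSmirnov2012, proof of Lemma 1] -/
theorem z2VertexIdentity_of_isBounded :
    ∀ (Ω : Set ℂ) (δ : ℝ) (a a' v : Literature.Probability.LatticeModels.Site 2), let H : Literature.Probability.LatticeModels.Site 2 → Literature.Probability.LatticeModels.Site 2 → ℂ := fun p q => ∑' γ : Literature.Probability.RandomPlanarGeometry.SAW.DomainSAW Ω δ a p, if s(p, q) ∈ γ.walk.edges then 0 else Complex.exp (-Complex.I * (5 / 8 : ℂ) * (Literature.Probability.LatticeModels.winding (Literature.Probability.LatticeModels.meshPoint δ a' :: (γ.walk.support.map (Literature.Probability.LatticeModels.meshPoint δ)) ++ [Literature.Probability.LatticeModels.medialPoint δ s(p, q)]) : ℝ)) * (Literature.Probability.RandomPlanarGeometry.SAW.criticalFugacity : ℂ) ^ (γ.length + 1); let T : Literature.Probability.LatticeModels.Site 2 → ℂ := fun d => ∑' γ : Literature.Probability.RandomPlanarGeometry.SAW.DomainSAW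 Ω δ a (v - d), if v ∈ γ.walk.support then 0 else Complex.exp (-Complex.I * (5 / 8 : ℂ) * (Literature.Probability.LatticeModels.winding (Literature.Probability.LatticeModels.meshPoint δ a' :: (γ.walk.support.map (Literature.Probability.LatticeModels.meshPoint δ)) ++ [Literature.Probability.LatticeModels.medialPoint δ s(v - d, v)]) : ℝ)) * (Literature.Probability.RandomPlanarGeometry.SAW.criticalFugacity : ℂ) ^ (γ.length + 1); let dir : Fin 4 → Literature.Probability.LatticeModels.Site 2 := ![![1, 0], ![0, 1], ![-1, 0], ![0, -1]]; let cdir : Fin 4 → ℂ := ![1, Complex.I, -1, -Complex.I]; 0 < δ → Bornology.IsBounded Ω → v ≠ a → (∀ i : Fin 4, (Literature.Probability.LatticeModels.discreteDomainGraph Ω δ).Adj v (v + dir i)) → ∑ i : Fin 4, cdir i * (H v (v + dir i) + H (v + dir i) v) = ((Literature.Probability.RandomPlanarGeometry.SAW.criticalFugacity : ℂ) * (1 + 2 * Real.sin (5 * Real.pi / 16)) - 1) * ∑ i : Fin 4, cdir i * T (dir i) - ∑ i : Fin 4, cdir i * (H (v - dir i) v - T (dir i)) := by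
  intro Ω δ a a' v
  simp only []
  intro hδ hΩ hva hadj
  rw [← Literature.Probability.LatticeModels.Polyline.winding_eq_winding'] -- buildfix 2026-08-20, as above
  exact vertex_identity (fun p => finite_domainSAW_of_finite (meshDomain_finite hΩ hδ) a p) hδ hva hadj

end Summit.CriticalPhenomena.SAWScalingLimit.Theorems.Z2Vertex

end
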